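import Summits.Parity.GeneralizedHardyLittlewood.Theorems.MaynardProductExactNumLB3749

/-! # Route `MaynardProductExact` — crux `NumLB3749` (stmt-Parity-19245): the registered stub BY NAME

Stub-credit record for the single registered stub `stub_numHoeffdingCert` of the line
`Cruxes/NumLB3749/Lines/birth.lean` (skeleton f3d6d0dd5406e4f5).  The stub was PROVED (signature verbatim) inside the accepted closer
`Theorems/MaynardProductExactNumLB3749.lean` as
`Summit.Parity.GeneralizedHardyLittlewood.MaynardProductExactNumLB3749.stub_numHoeffdingCert` (the `k = 3750` kernel certificate,
`ProductKernelCert3750.stub_of_factsSL` on the facts `okT okCh okSl0–okSl7 okFin okQ0–okQ2 okS`), and the crux itself is closed by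
`numLB3749_proof` of that file.  This file only re-exports that theorem under the stub's registered name as a `--supports` landing, so
that the ledger's stub record is credited by name; it proves nothing new.  Rung F-P1.R4 bookkeeping; no summit is proved here. -/

noncomputable section

open MeasureTheory Set Finset
open Literature.Analysis.Convolution Literature.NumberTheory.Sieve Literature.NumberTheory.Sieve.MaynardTao

namespace Summit.Parity.GeneralizedHardyLittlewood.MaynardProductExactNumLB3749Stub

/-- **The registered stub `stub_numHoeffdingCert` of crux `NumLB3749`** (signature verbatim): some lattice `h > 0` with
`J_c h > 3/4`, a window `M`, a shift `δ` and a tail parameter `λ ≥ 0` satisfying the recentring side condition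
`δ + λ ≤ 3749·(h − (∫ r_h g²)/m₂)` and the finite inequality
`19076·10⁻¹⁰·m₂^{3749} ≤ Σ_{m<M} (∫_{(0,1−((m+3749)h−δ)]} g)² (p^{∗3749})_m − (∫_{(0,3/4]} g)² · m₂^{3749} e^{−2λ²/(3749 h²)}`
(`g = polymathProfile 3750 (249/2000) (3/4)`, `p = cellMass g² h`, `m₂ = 10⁶/466771167`).  Proof: the accepted theorem
`MaynardProductExactNumLB3749.stub_numHoeffdingCert` (kernel certificate). -/
theorem stub_numHoeffdingCert :
    ∃ (h : ℝ) (Jc M : ℕ) (δ lam : ℝ), 0 < h ∧ (3 : ℝ) / 4 < (Jc : ℝ) * h ∧ 0 ≤ lam ∧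
      δ + lam ≤ (3749 : ℝ) * (h -
        (∫ x in Ici 0, roundErr h x * polymathProfile 3750 ((249 : ℝ) / 2000) ((3 : ℝ) / 4) x ^ 2) /
          ((1000000 : ℝ) / 466771167)) ∧
      (19076 : ℝ) / 10000000000 * ((1000000 : ℝ) / 466771167) ^ 3749 ≤
        ∑ m ∈ range M,
            (∫ u in Ioc 0 (1 - ((((m + 3749 : ℕ) : ℝ)) * h - δ)),
                polymathProfile 3750 ((249 : ℝ) / 2000) ((3 : ℝ) / 4) u) ^ 2 *
              dconvPow (cellMass (fun t => polymathProfile 3750 ((249 : ℝ) / 2000) ((3 : ℝ) / 4) t ^ 2) h) 3749 m -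
          (∫ u in Ioc 0 ((3 : ℝ) / 4), polymathProfile 3750 ((249 : ℝ) / 2000) ((3 : ℝ) / 4) u) ^ 2 *
            (((1000000 : ℝ) / 466771167) ^ 3749 * Real.exp (-2 * lam ^ 2 / ((3749 : ℝ) * h ^ 2))) :=
  MaynardProductExactNumLB3749.stub_numHoeffdingCert

end Summit.Parity.GeneralizedHardyLittlewood.MaynardProductExactNumLB3749Stub

end
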